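import Literature.Geometry.DiscreteGeometry.LayerPinning
import Literature.MathematicalPhysics.StatisticalMechanics.BarlowStacking
import HarnessLib

/-!
# Layer pinning in the Barlow-stacking frame of the tree

Topic `Literature/MathematicalPhysics/StatisticalMechanics`; corollaries of
`Literature/Geometry/DiscreteGeometry/LayerPinning` for the model layers `barlowPos 1 √(2/3) s k i j`
(`BarlowStacking`: layer `k` = the unit triangular lattice `{(i + j/2 + L/2, (√3/2)(j + L/3))}` at height
`k√(2/3)`, `L = haggLabel s k`), as asked by the cell `crystal3d-full` (planner R41u / regime (β1), the
frame of `…NoReconstructionGainLayerCover.hollow_height_sq`): a ball strictly between two COMPLETE layers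
`k` and `k + 2` (every site of both at distance `≥ 1` from it) sits at height `(k+1)√(2/3)` exactly and at
a site of letter `L + 1` or `L + 2` over layer `k` — i.e. at a site of layer `k + 1` of SOME Barlow stacking
with the same layer `k` (Hales's «two choices for the placement of the next layer»).
[cite: HalesDSP2012, §1.3 p. 12 (Fig. 1.12)]

* `barlow_layer_pinning` — the statement above (gap `2√(2/3)`: one layer between).
* `barlow_layer_pinning_three` — layers `k` and `k + 3` complete: every ball strictly between has height in
  `[(k+1)√(2/3), (k+2)√(2/3)]` (the Σ3 twin-wall period; interior-slab balls are not pinned).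
* `barlow_hollow_of_minimal_height` — a ball at height exactly `(k+1)√(2/3)` over a complete layer `k` is at
  a letter-`L+1` or letter-`L+2` site.
* `…_local` — the same three with the hard core asked only for the sites within planar squared distance `1/3`
  of `q`'s foot (≤ 3 per layer): the form to use with a finite `1`-separated packing.

Moved / rotated grains: transport by the isometry as in `…CapRigidity.rung_offLatticeMoved` (Theorems side).
WHAT THIS IS NOT: no statement about which of the pinned sites are occupied; no wall statement.
-/

noncomputable section

namespace Literature.MathematicalPhysics.StatisticalMechanics

open Real
open Literature.Geometry.DiscreteGeometry

/-- The sites of layer `k` of `barlowPos 1 √(2/3) s` form a complete-layer family in the coordinates of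
`LayerPinning` with `c₀ = L/2`, `c₁ = (√3/2)(L/3)`, `h = k√(2/3)`, `L = haggLabel s k`. [folklore] -/
private theorem layer_family (s : ℤ → ℤ) (k : ℤ) (q : EuclideanSpace ℝ (Fin 3))
    (hX : ∀ i j : ℤ, 1 ≤ ‖q - barlowPos 1 (Real.sqrt (2 / 3)) s k i j‖) :
    ∀ a b : ℤ, ∃ p : EuclideanSpace ℝ (Fin 3),
      p 0 = (haggLabel s k : ℝ) / 2 + a + b / 2 ∧
      p 1 = Real.sqrt 3 / 2 * ((haggLabel s k : ℝ) / 3) + b * (Real.sqrt 3 / 2) ∧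
      p 2 = (k : ℝ) * Real.sqrt (2 / 3) ∧ 1 ≤ ‖q - p‖ := by
  intro a b
  refine ⟨barlowPos 1 (Real.sqrt (2 / 3)) s k a b, ?_, ?_, ?_, hX a b⟩
  · rw [barlowPos_apply_zero]; ring
  · rw [barlowPos_apply_one]; ring
  · rw [barlowPos_apply_two]

/-- **Layer pinning in the Barlow frame.**  Let layers `k` and `k + 2` of the model stacking
`barlowPos 1 √(2/3) s` be complete around `q` in the sense that every one of their sites is at distance
`≥ 1` from `q`, and let `q` lie strictly between them.  Then `q₂ = (k+1)√(2/3)` and `q` is a site of letter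
`L + 1` or `L + 2` (`L = haggLabel s k`): `q₀ = i + j/2 + (L+e)/2`, `q₁ = (√3/2)(j + (L+e)/3)`, `e ∈ {1,2}` —
one of Hales's two placements of the next layer. [cite: HalesDSP2012, §1.3 p. 12 (Fig. 1.12)] -/
theorem barlow_layer_pinning (s : ℤ → ℤ) (k : ℤ) (q : EuclideanSpace ℝ (Fin 3))
    (hlo : (k : ℝ) * Real.sqrt (2 / 3) < q 2) (hhi : q 2 < ((k : ℝ) + 2) * Real.sqrt (2 / 3))
    (hlow : ∀ i j : ℤ, 1 ≤ ‖q - barlowPos 1 (Real.sqrt (2 / 3)) s k i j‖)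
    (hup : ∀ i j : ℤ, 1 ≤ ‖q - barlowPos 1 (Real.sqrt (2 / 3)) s (k + 2) i j‖) :
    q 2 = ((k : ℝ) + 1) * Real.sqrt (2 / 3) ∧
      ∃ e i j : ℤ, (e = 1 ∨ e = 2) ∧ q 0 = i + j / 2 + ((haggLabel s k : ℝ) + e) / 2 ∧
        q 1 = Real.sqrt 3 / 2 * (j + ((haggLabel s k : ℝ) + e) / 3) := by
  have h1 := layer_family s k q hlow
  have h2 := layer_family s (k + 2) q hup
  push_cast at h2
  have hsep : ((k : ℝ) + 2) * Real.sqrt (2 / 3) - (k : ℝ) * Real.sqrt (2 / 3) = 2 * Real.sqrt (2 / 3) := by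
    ring
  obtain ⟨hz, a, b, hab⟩ := layer_pinning_hollow q _ _ _ _ _ _ hlo hhi hsep h1 h2
  refine ⟨by rw [hz]; ring, ?_⟩
  rcases hab with ⟨hx, hy⟩ | ⟨hx, hy⟩
  · exact ⟨1, a, b, Or.inl rfl, by rw [hx]; push_cast; ring, by rw [hy]; push_cast; ring⟩
  · exact ⟨2, a, b, Or.inr rfl, by rw [hx]; push_cast; ring, by rw [hy]; push_cast; ring⟩

/-- **The twin-wall period in the Barlow frame.**  Layers `k` and `k + 3` complete around `q` (every site at
distance `≥ 1`), `q` strictly between ⇒ `(k+1)√(2/3) ≤ q₂ ≤ (k+2)√(2/3)`. [cite: HalesDSP2012, §1.3 p. 12 (Fig. 1.12)] -/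
theorem barlow_layer_pinning_three (s : ℤ → ℤ) (k : ℤ) (q : EuclideanSpace ℝ (Fin 3))
    (hlo : (k : ℝ) * Real.sqrt (2 / 3) < q 2) (hhi : q 2 < ((k : ℝ) + 3) * Real.sqrt (2 / 3))
    (hlow : ∀ i j : ℤ, 1 ≤ ‖q - barlowPos 1 (Real.sqrt (2 / 3)) s k i j‖)
    (hup : ∀ i j : ℤ, 1 ≤ ‖q - barlowPos 1 (Real.sqrt (2 / 3)) s (k + 3) i j‖) :
    ((k : ℝ) + 1) * Real.sqrt (2 / 3) ≤ q 2 ∧ q 2 ≤ ((k : ℝ) + 2) * Real.sqrt (2 / 3) := by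
  have h1 := layer_family s k q hlow
  have h2 := layer_family s (k + 3) q hup
  push_cast at h2
  have hsep : ((k : ℝ) + 3) * Real.sqrt (2 / 3) - (k : ℝ) * Real.sqrt (2 / 3) = 3 * Real.sqrt (2 / 3) := by
    ring
  obtain ⟨ha, hb⟩ := layer_pinning_three q _ _ _ _ _ _ hlo hhi hsep h1 h2
  constructor <;> linarith

/-- A ball at height exactly `(k+1)√(2/3)` over a complete layer `k` (every site at distance `≥ 1`) is at a
letter-`L+1` or letter-`L+2` site, `L = haggLabel s k`. [cite: HalesDSP2012, §1.3 p. 12 (Fig. 1.12)] -/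
theorem barlow_hollow_of_minimal_height (s : ℤ → ℤ) (k : ℤ) (q : EuclideanSpace ℝ (Fin 3))
    (hz : q 2 = ((k : ℝ) + 1) * Real.sqrt (2 / 3))
    (hlow : ∀ i j : ℤ, 1 ≤ ‖q - barlowPos 1 (Real.sqrt (2 / 3)) s k i j‖) :
    ∃ e i j : ℤ, (e = 1 ∨ e = 2) ∧ q 0 = i + j / 2 + ((haggLabel s k : ℝ) + e) / 2 ∧
      q 1 = Real.sqrt 3 / 2 * (j + ((haggLabel s k : ℝ) + e) / 3) := by
  have h1 := layer_family s k q hlow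
  have hz' : q 2 = (k : ℝ) * Real.sqrt (2 / 3) + Real.sqrt (2 / 3) := by rw [hz]; ring
  obtain ⟨a, b, hab⟩ := hollow_of_minimal_height q _ _ _ hz' h1
  rcases hab with ⟨hx, hy⟩ | ⟨hx, hy⟩
  · exact ⟨1, a, b, Or.inl rfl, by rw [hx]; push_cast; ring, by rw [hy]; push_cast; ring⟩
  · exact ⟨2, a, b, Or.inr rfl, by rw [hx]; push_cast; ring, by rw [hy]; push_cast; ring⟩

/-! ## Local forms (finite packings): only the sites within planar distance `1/√3` of the ball's foot matter -/

/-- Planar squared distance from `q`'s foot to the site `(i, j)` of layer `k` of `barlowPos 1 √(2/3) s`, in the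
coordinates of `LayerPinning` (`c₀ = L/2`, `c₁ = (√3/2)(L/3)`, `L = haggLabel s k`). [folklore] -/
private theorem planar_sq_eq (s : ℤ → ℤ) (k i j : ℤ) (q : EuclideanSpace ℝ (Fin 3)) :
    (q 0 - (haggLabel s k : ℝ) / 2 - (i + j / 2)) ^ 2
      + (q 1 - Real.sqrt 3 / 2 * ((haggLabel s k : ℝ) / 3) - j * (Real.sqrt 3 / 2)) ^ 2
      = (q 0 - barlowPos 1 (Real.sqrt (2 / 3)) s k i j 0) ^ 2 + (q 1 - barlowPos 1 (Real.sqrt (2 / 3)) s k i j 1) ^ 2 := by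
  rw [barlowPos_apply_zero, barlowPos_apply_one]; ring

/-- Local complete-layer family: the hard core is asked only for the sites of layer `k` within planar squared
distance `1/3` of `q`'s foot. [folklore] -/
private theorem layer_family_local (s : ℤ → ℤ) (k : ℤ) (q : EuclideanSpace ℝ (Fin 3))
    (hX : ∀ i j : ℤ, (q 0 - barlowPos 1 (Real.sqrt (2 / 3)) s k i j 0) ^ 2 +
        (q 1 - barlowPos 1 (Real.sqrt (2 / 3)) s k i j 1) ^ 2 ≤ 1 / 3 →
      1 ≤ ‖q - barlowPos 1 (Real.sqrt (2 / 3)) s k i j‖) :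
    ∀ a b : ℤ, (q 0 - (haggLabel s k : ℝ) / 2 - (a + b / 2)) ^ 2
        + (q 1 - Real.sqrt 3 / 2 * ((haggLabel s k : ℝ) / 3) - b * (Real.sqrt 3 / 2)) ^ 2 ≤ 1 / 3 →
      ∃ p : EuclideanSpace ℝ (Fin 3),
        p 0 = (haggLabel s k : ℝ) / 2 + a + b / 2 ∧
        p 1 = Real.sqrt 3 / 2 * ((haggLabel s k : ℝ) / 3) + b * (Real.sqrt 3 / 2) ∧
        p 2 = (k : ℝ) * Real.sqrt (2 / 3) ∧ 1 ≤ ‖q - p‖ := by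
  intro a b hab
  rw [planar_sq_eq] at hab
  refine ⟨barlowPos 1 (Real.sqrt (2 / 3)) s k a b, ?_, ?_, ?_, hX a b hab⟩
  · rw [barlowPos_apply_zero]; ring
  · rw [barlowPos_apply_one]; ring
  · rw [barlowPos_apply_two]

/-- **Local layer pinning in the Barlow frame** (the form for a finite `1`-separated packing `X ∋ q`): if every
site of layers `k` and `k + 2` of `barlowPos 1 √(2/3) s` within PLANAR squared distance `1/3` of `q`'s foot is at
distance `≥ 1` from `q` (e.g. is a ball of `X` other than `q`), and `k√(2/3) < q₂ < (k+2)√(2/3)`, then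
`q₂ = (k+1)√(2/3)` and `q` is a letter-`L+1` or letter-`L+2` site, `L = haggLabel s k`.
[cite: HalesDSP2012, §1.3 p. 12 (Fig. 1.12)] -/
theorem barlow_layer_pinning_local (s : ℤ → ℤ) (k : ℤ) (q : EuclideanSpace ℝ (Fin 3))
    (hlo : (k : ℝ) * Real.sqrt (2 / 3) < q 2) (hhi : q 2 < ((k : ℝ) + 2) * Real.sqrt (2 / 3))
    (hlow : ∀ i j : ℤ, (q 0 - barlowPos 1 (Real.sqrt (2 / 3)) s k i j 0) ^ 2 +
        (q 1 - barlowPos 1 (Real.sqrt (2 / 3)) s k i j 1) ^ 2 ≤ 1 / 3 →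
      1 ≤ ‖q - barlowPos 1 (Real.sqrt (2 / 3)) s k i j‖)
    (hup : ∀ i j : ℤ, (q 0 - barlowPos 1 (Real.sqrt (2 / 3)) s (k + 2) i j 0) ^ 2 +
        (q 1 - barlowPos 1 (Real.sqrt (2 / 3)) s (k + 2) i j 1) ^ 2 ≤ 1 / 3 →
      1 ≤ ‖q - barlowPos 1 (Real.sqrt (2 / 3)) s (k + 2) i j‖) :
    q 2 = ((k : ℝ) + 1) * Real.sqrt (2 / 3) ∧
      ∃ e i j : ℤ, (e = 1 ∨ e = 2) ∧ q 0 = i + j / 2 + ((haggLabel s k : ℝ) + e) / 2 ∧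
        q 1 = Real.sqrt 3 / 2 * (j + ((haggLabel s k : ℝ) + e) / 3) := by
  have h1 := layer_family_local s k q hlow
  have h2 := layer_family_local s (k + 2) q hup
  push_cast at h2
  have hsep : ((k : ℝ) + 2) * Real.sqrt (2 / 3) - (k : ℝ) * Real.sqrt (2 / 3) = 2 * Real.sqrt (2 / 3) := by
    ring
  obtain ⟨hz, a, b, hab⟩ := layer_pinning_hollow_local q _ _ _ _ _ _ hlo hhi hsep h1 h2
  refine ⟨by rw [hz]; ring, ?_⟩
  rcases hab with ⟨hx, hy⟩ | ⟨hx, hy⟩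
  · exact ⟨1, a, b, Or.inl rfl, by rw [hx]; push_cast; ring, by rw [hy]; push_cast; ring⟩
  · exact ⟨2, a, b, Or.inr rfl, by rw [hx]; push_cast; ring, by rw [hy]; push_cast; ring⟩

/-- Local slab form (layers `k`, `k + 3`): `(k+1)√(2/3) ≤ q₂ ≤ (k+2)√(2/3)` from the local hard core alone.
[cite: HalesDSP2012, §1.3 p. 12 (Fig. 1.12)] -/
theorem barlow_layer_pinning_three_local (s : ℤ → ℤ) (k : ℤ) (q : EuclideanSpace ℝ (Fin 3))
    (hlo : (k : ℝ) * Real.sqrt (2 / 3) < q 2) (hhi : q 2 < ((k : ℝ) + 3) * Real.sqrt (2 / 3))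
    (hlow : ∀ i j : ℤ, (q 0 - barlowPos 1 (Real.sqrt (2 / 3)) s k i j 0) ^ 2 +
        (q 1 - barlowPos 1 (Real.sqrt (2 / 3)) s k i j 1) ^ 2 ≤ 1 / 3 →
      1 ≤ ‖q - barlowPos 1 (Real.sqrt (2 / 3)) s k i j‖)
    (hup : ∀ i j : ℤ, (q 0 - barlowPos 1 (Real.sqrt (2 / 3)) s (k + 3) i j 0) ^ 2 +
        (q 1 - barlowPos 1 (Real.sqrt (2 / 3)) s (k + 3) i j 1) ^ 2 ≤ 1 / 3 →
      1 ≤ ‖q - barlowPos 1 (Real.sqrt (2 / 3)) s (k + 3) i j‖) :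
    ((k : ℝ) + 1) * Real.sqrt (2 / 3) ≤ q 2 ∧ q 2 ≤ ((k : ℝ) + 2) * Real.sqrt (2 / 3) := by
  have h1 := layer_family_local s k q hlow
  have h2 := layer_family_local s (k + 3) q hup
  push_cast at h2
  obtain ⟨ha, hb⟩ := layer_pinning_local q _ _ _ _ _ _ hlo hhi h1 h2
  constructor <;> nlinarith [Real.sqrt_nonneg (2 / 3)]

/-- Local form of `barlow_hollow_of_minimal_height`. [cite: HalesDSP2012, §1.3 p. 12 (Fig. 1.12)] -/
theorem barlow_hollow_of_minimal_height_local (s : ℤ → ℤ) (k : ℤ) (q : EuclideanSpace ℝ (Fin 3))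
    (hz : q 2 = ((k : ℝ) + 1) * Real.sqrt (2 / 3))
    (hlow : ∀ i j : ℤ, (q 0 - barlowPos 1 (Real.sqrt (2 / 3)) s k i j 0) ^ 2 +
        (q 1 - barlowPos 1 (Real.sqrt (2 / 3)) s k i j 1) ^ 2 ≤ 1 / 3 →
      1 ≤ ‖q - barlowPos 1 (Real.sqrt (2 / 3)) s k i j‖) :
    ∃ e i j : ℤ, (e = 1 ∨ e = 2) ∧ q 0 = i + j / 2 + ((haggLabel s k : ℝ) + e) / 2 ∧
      q 1 = Real.sqrt 3 / 2 * (j + ((haggLabel s k : ℝ) + e) / 3) := by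
  have h1 := layer_family_local s k q hlow
  have hz' : q 2 = (k : ℝ) * Real.sqrt (2 / 3) + Real.sqrt (2 / 3) := by rw [hz]; ring
  obtain ⟨a, b, hab⟩ := hollow_of_minimal_height_local q _ _ _ hz' h1
  rcases hab with ⟨hx, hy⟩ | ⟨hx, hy⟩
  · exact ⟨1, a, b, Or.inl rfl, by rw [hx]; push_cast; ring, by rw [hy]; push_cast; ring⟩
  · exact ⟨2, a, b, Or.inr rfl, by rw [hx]; push_cast; ring, by rw [hy]; push_cast; ring⟩

end Literature.MathematicalPhysics.StatisticalMechanics
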